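/-
Copyright (c) 2026 the pub-hodgecm-mathlib formalisation cell (harness21).  Prover seat hodgecm-mathlib-LH4-p01 (g0): road «S3-ram» (LEAD F0P3a-plan (g13) T12-3 (3),
deal «NO-TV»; cut F0P3a-p04 (g19) 01:54:47Z; junction pen F0P3a-p01 (g17), skeleton v7 326c2913e2b823a2); 2026-09-02.
-/
import Literature.NumberTheory.Automorphic.UnitaryThreeBoundaryRigidityLevelTwoRamified        -- ★ B-p14 (g37): `isIntMatrix_smul_sub_one_of_sq_of_residual_trivial` (the `O₃(𝓀)` core over ★ `eq_one_of_mem_orthogonal_of_sq_sub_one_eq_zero`)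
import Literature.NumberTheory.Automorphic.UnitaryLatticeTreeFixedGrandchildrenCountRamified    -- ★ G3⁺: `mem_unitaryInt_conj_of_latticeGraphIso_apply_root_eq` (`u⁻¹γu ∈ K₀`)
import Literature.NumberTheory.Automorphic.UnitaryLatticeTreeFixedChildTokensRamified           -- ★ FILE H §0: `map_toLin'_latt_le_scaleLattice_iff` (tokens ↔ entries)
import Literature.NumberTheory.Automorphic.UnitaryLatticeTreeSelfDualTransitiveTame             -- ★ `exists_latticeGraphIso_root_eq_of_v_two` (`v = u·L₀`)
import HarnessLib

/-!
# The lattice graph of a hermitian space at a TAMELY RAMIFIED place — «NO-TV»: the rank token `LEV₂(ϖ)` forces the depth token `LEV(ϖ)` at a fixed self-dual vertex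
# (Kottwitz 1986 §3; Tits 1979 §3.5; Rogawski 1990 §3.9)

Topic `NumberTheory/Automorphic`; namespace `Literature.NumberTheory.Automorphic.UnitaryLatticeTree`.  THEOREMS ONLY (no definition, no instance, no notation, no named fact,
no `sorry`); kernel lane `--supports stmt-HodgeConjecture-24833`.  Cell `pub/hodgecm-mathlib` (D-0151), crux H413; road «S3-ram» (Literature seeding, count-neutral); the
(a2) JUNCTION of the type-(1) ramified row (pen F0P3a-p01 (g17), skeleton v7 326c2913e2b823a2), assembly lemma L3 `engineRows_of_rows`, conjunct `hB`
(`dep v = 0 → GC v = ∅`, closed by ★ `fixedGrandchildren_eq_empty_of_levelZero` whose `hrk` binder is `¬ LEV₂[v](ϖ)`): this file supplies the token **NO-TV**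
«`LEV₂[v](ϖ) → LEV[v](ϖ)` at a `γ`-fixed self-dual vertex `v`», so that `dep v = 0` (`¬ LEV[v](ϖ)`) yields `¬ LEV₂[v](ϖ)`.

SETTING: a valued field `K` (`Valued K ℤᵐ⁰`) with an involution `σ` preserving `v` and RESIDUALLY TRIVIAL on `𝒪` (`hres`, the tame-ramified block), a uniformiser `ϖ`
(`|ϖ| = exp(−1)`), `|2| = 1`; `J₀ = antidiag(1,1,1)`, `U = U(σ, J₀)`, `K₀ = U ∩ GL₃(𝒪)` (★ `unitaryInt`); tokens in the junction's spelling
`LEV[v](c) := v.1.map (toLin' (γ − 1)) ≤ scaleLattice c v.1`, `LEV₂[v](c) := v.1.map (toLin' ((γ − 1)²)) ≤ scaleLattice c v.1`.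

THE MATHEMATICS.  Write `v = u·L₀` (★ `exists_latticeGraphIso_root_eq_of_v_two`: `U` is transitive on self-dual vertices when `|2| = 1`) and `γ′ := u⁻¹γu`; since `γ`
fixes `v`, `γ′ ∈ K₀` (★ `mem_unitaryInt_conj_of_latticeGraphIso_apply_root_eq`).  In the frame `u` the tokens are entrywise congruences (★ `map_toLin'_latt_le_scaleLattice_iff`):
`LEV₂[v](ϖ) ↔ (γ′ − 1)² ≡ 0 (mod ϖ)` and `LEV[v](ϖ) ↔ γ′ ≡ 1 (mod ϖ)`.  The reduction `γ̄′` lies in the ORTHOGONAL group `O(J̄₀)(𝓀)` (`σ̄ = id`), which has no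
transvections when `2 ≠ 0`, so `(γ̄′ − 1)² = 0 ⇒ γ̄′ = 1` — ★ `isIntMatrix_smul_sub_one_of_sq_of_residual_trivial` (B-p14 (g37), over ★
`eq_one_of_mem_orthogonal_of_sq_sub_one_eq_zero`).  Reading back gives `LEV[v](ϖ)`.

* §1 **`lev_of_lev₂_of_fixed_selfDual`** — NO-TV in the junction's binder order `(hσ hvσ hσϖ hϖ hres h2) {γ} (hγ0) {v} (hv) (hfix) (h)`;
  `not_lev₂_of_not_lev_of_fixed_selfDual` — its contrapositive (the `hrk` binder of ★ `fixedGrandchildren_eq_empty_of_levelZero` from `¬ LEV[v](ϖ)`).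

HONEST LABEL: HC_CM is proved only modulo the 2 remaining named inputs (hLiu418 24832, h413 24833) until rung 0 closes; elementary matrix algebra over a valued field
(bookkeeping over ★ rows); «S3-ram» has no books consequence.

## References
* [Kottwitz1986] R. E. Kottwitz, *Base change for unit elements of Hecke algebras*, Compositio Math. 60 (1986), §3 (levels of fixed lattices; shell recursion).
* [Tits1979] J. Tits, *Reductive groups over local fields*, PSPM 33.1 (1979), §3.5 (congruence filtration; special fibre of a parahoric).
* [Rogawski1990] J. D. Rogawski, *Automorphic Representations of Unitary Groups in Three Variables*, Ann. of Math. Stud. 123 (1990), §3.9 p. 32.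
* [Serre1980Trees] J.-P. Serre, *Trees* (1980), Ch. II §1.1 (lattices `latt g`, change of frame, congruence level).
-/

set_option autoImplicit false

noncomputable section

open scoped Valued WithZero Matrix MatrixGroups

namespace Literature.NumberTheory.Automorphic.UnitaryLatticeTree

open Literature.NumberTheory.Automorphic Literature.NumberTheory.Automorphic.HermitianLattice
open Literature.NumberTheory.Automorphic.CartanUnique Literature.NumberTheory.Automorphic.UnitaryGroup

variable {K : Type*} [Field K] [Valued K ℤᵐ⁰] {σ : K →+* K} {ϖ : K}

/-! ## §1 NO-TV: `LEV₂[v](ϖ) → LEV[v](ϖ)` at a fixed self-dual vertex -/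

/-- **NO-TV — THE RANK TOKEN AT LEVEL `ϖ` FORCES THE DEPTH TOKEN**: at a tamely ramified place (`σ` residually trivial, `|2| = 1`), for `γ ∈ K₀` and a `γ`-fixed
self-dual vertex `v`, `(γ − 1)²·v ⊆ ϖ·v ⇒ (γ − 1)·v ⊆ ϖ·v`.  In the frame `v = u·L₀`, `γ′ = u⁻¹γu ∈ K₀` reduces to an element of `O(J̄₀)(𝓀)` with `(γ̄′ − 1)² = 0`,
hence `γ̄′ = 1` (no transvections in `O₃`, `char 𝓀 ≠ 2`: ★ `isIntMatrix_smul_sub_one_of_sq_of_residual_trivial`).  Binder order = the junction's (skeleton v7,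
F0P3a-p04 (g19)'s cut); `hσϖ`, `hγ0` are carried for the socket shape and not used. [cite: Kottwitz1986, §3] [cite: Tits1979, §3.5] [cite: Rogawski1990, §3.9 p. 32]
[cite: Serre1980Trees, II.1.1] -/
theorem lev_of_lev₂_of_fixed_selfDual (hσ : ∀ x, σ (σ x) = x) (hvσ : ∀ a, Valued.v (σ a) = Valued.v a) (_hσϖ : σ ϖ = -ϖ)
    (hϖ : Valued.v ϖ = WithZero.exp (-1 : ℤ)) (hres : ∀ x : K, Valued.v x ≤ 1 → Valued.v (σ x - x) < 1) (h2 : Valued.v (2 : K) = 1)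
    {γ : unitaryGroupOfForm σ ((StdForm.antidiagonal 3).over K)} (_hγ0 : γ ∈ unitaryInt σ ((StdForm.antidiagonal 3).over K))
    {v : {M : Submodule 𝒪[K] (Fin 3 → K) // IsVertex σ ϖ ((StdForm.antidiagonal 3).over K) M}}
    (hv : IsSelfDualLattice σ ϖ ((StdForm.antidiagonal 3).over K) v.1)
    (hfix : latticeGraphIso σ ϖ ((StdForm.antidiagonal 3).over K) γ v = v)
    (h : v.1.map ((Matrix.toLin' ((((γ : GL (Fin 3) K) : Matrix (Fin 3) (Fin 3) K) - 1) ^ 2)).restrictScalars 𝒪[K]) ≤ scaleLattice ϖ v.1) :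
    v.1.map ((Matrix.toLin' (((γ : GL (Fin 3) K) : Matrix (Fin 3) (Fin 3) K) - 1)).restrictScalars 𝒪[K]) ≤ scaleLattice ϖ v.1 := by
  have hϖ0 : ϖ ≠ 0 := uniformizer_ne_zero hϖ
  -- `v = u·L₀`, `γ′ = u⁻¹γu ∈ K₀`
  obtain ⟨u, hu⟩ := exists_latticeGraphIso_root_eq_of_v_two hσ hvσ hϖ h2 v hv (isSelfDualLattice_stdLattice_three_of_v hϖ)
  subst hu
  have hγK : u⁻¹ * γ * u ∈ unitaryInt σ ((StdForm.antidiagonal 3).over K) := mem_unitaryInt_conj_of_latticeGraphIso_apply_root_eq hfix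
  -- the dictionary of the frame `u`: `u·L₀ = latt u`, `u⁻¹ (γ − 1)ⁿ u = (γ′ − 1)ⁿ`
  have hUdet : IsUnit ((u : GL (Fin 3) K) : Matrix (Fin 3) (Fin 3) K).det := Matrix.isUnits_det_units _
  have hlatt : (latticeGraphIso σ ϖ ((StdForm.antidiagonal 3).over K) u ⟨stdLattice K 3, 0, isSelfDualLattice_stdLattice_three_of_v hϖ⟩).1 =
      latt ((u : GL (Fin 3) K) : Matrix (Fin 3) (Fin 3) K) := rfl
  have hconj : ∀ n : ℕ, ((u : GL (Fin 3) K) : Matrix (Fin 3) (Fin 3) K)⁻¹ * (((γ : GL (Fin 3) K) : Matrix (Fin 3) (Fin 3) K) - 1) ^ n * ((u : GL (Fin 3) K) : Matrix (Fin 3) (Fin 3) K) =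
      (((((u⁻¹ * γ * u : unitaryGroupOfForm σ ((StdForm.antidiagonal 3).over K))) : GL (Fin 3) K) : Matrix (Fin 3) (Fin 3) K) - 1) ^ n := by
    intro n
    rw [← Matrix.coe_units_inv, ← Units.conj_pow', Matrix.mul_sub, Matrix.sub_mul, Matrix.mul_one, Units.inv_mul,
      Subgroup.coe_mul, Subgroup.coe_mul, Subgroup.coe_inv, Units.val_mul, Units.val_mul]
  have hconj1 : ((u : GL (Fin 3) K) : Matrix (Fin 3) (Fin 3) K)⁻¹ * (((γ : GL (Fin 3) K) : Matrix (Fin 3) (Fin 3) K) - 1) * ((u : GL (Fin 3) K) : Matrix (Fin 3) (Fin 3) K) =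
      ((((u⁻¹ * γ * u : unitaryGroupOfForm σ ((StdForm.antidiagonal 3).over K))) : GL (Fin 3) K) : Matrix (Fin 3) (Fin 3) K) - 1 := by
    have h1 := hconj 1
    rwa [pow_one, pow_one] at h1
  -- read the rank token on `γ′`: `(γ′ − 1)² ≡ 0 (mod ϖ)`
  rw [hlatt, map_toLin'_latt_le_scaleLattice_iff hϖ0 _ hUdet, hconj] at h
  have hx2 : IsIntMatrix (ϖ⁻¹ • (((((u⁻¹ * γ * u : unitaryGroupOfForm σ ((StdForm.antidiagonal 3).over K))) : GL (Fin 3) K) : Matrix (Fin 3) (Fin 3) K) - 1) ^ 2) :=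
    (isIntMatrix_inv_smul_iff hϖ0 _).2 h
  have hxint : IsIntMatrix ((((u⁻¹ * γ * u : unitaryGroupOfForm σ ((StdForm.antidiagonal 3).over K))) : GL (Fin 3) K) : Matrix (Fin 3) (Fin 3) K) :=
    (mem_unitaryInt_iff.1 hγK).1
  -- the `O₃(𝓀)` core: `γ′ ≡ 1 (mod ϖ)`
  have key : IsIntMatrix (ϖ⁻¹ • (((((u⁻¹ * γ * u : unitaryGroupOfForm σ ((StdForm.antidiagonal 3).over K))) : GL (Fin 3) K) : Matrix (Fin 3) (Fin 3) K) - 1)) :=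
    isIntMatrix_smul_sub_one_of_sq_of_residual_trivial hϖ hres h2 (u⁻¹ * γ * u).2 hxint hx2
  -- read back the depth token
  rw [hlatt, map_toLin'_latt_le_scaleLattice_iff hϖ0 _ hUdet, hconj1]
  exact (isIntMatrix_inv_smul_iff hϖ0 _).1 key

/-- **NO-TV, contrapositive** — the `hrk` binder of ★ `fixedGrandchildren_eq_empty_of_levelZero` at a fixed self-dual vertex of depth label `0`: `¬ (γ − 1)·v ⊆ ϖ·v ⇒
¬ (γ − 1)²·v ⊆ ϖ·v`. [cite: Kottwitz1986, §3] [cite: Tits1979, §3.5] -/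
theorem not_lev₂_of_not_lev_of_fixed_selfDual (hσ : ∀ x, σ (σ x) = x) (hvσ : ∀ a, Valued.v (σ a) = Valued.v a) (hσϖ : σ ϖ = -ϖ)
    (hϖ : Valued.v ϖ = WithZero.exp (-1 : ℤ)) (hres : ∀ x : K, Valued.v x ≤ 1 → Valued.v (σ x - x) < 1) (h2 : Valued.v (2 : K) = 1)
    {γ : unitaryGroupOfForm σ ((StdForm.antidiagonal 3).over K)} (hγ0 : γ ∈ unitaryInt σ ((StdForm.antidiagonal 3).over K))
    {v : {M : Submodule 𝒪[K] (Fin 3 → K) // IsVertex σ ϖ ((StdForm.antidiagonal 3).over K) M}}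
    (hv : IsSelfDualLattice σ ϖ ((StdForm.antidiagonal 3).over K) v.1)
    (hfix : latticeGraphIso σ ϖ ((StdForm.antidiagonal 3).over K) γ v = v)
    (h : ¬ v.1.map ((Matrix.toLin' (((γ : GL (Fin 3) K) : Matrix (Fin 3) (Fin 3) K) - 1)).restrictScalars 𝒪[K]) ≤ scaleLattice ϖ v.1) :
    ¬ v.1.map ((Matrix.toLin' ((((γ : GL (Fin 3) K) : Matrix (Fin 3) (Fin 3) K) - 1) ^ 2)).restrictScalars 𝒪[K]) ≤ scaleLattice ϖ v.1 :=
  fun h2' => h (lev_of_lev₂_of_fixed_selfDual hσ hvσ hσϖ hϖ hres h2 hγ0 hv hfix h2')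

end Literature.NumberTheory.Automorphic.UnitaryLatticeTree

end
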